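/-
Origin: expansion seat `planner-pub-hodgecm-mc-axioms-1-g14-0`, handover #W37 2026-08-20T15:53:55Z md5 5cce3f547605 (PKG cbc530cdaca1 → 5cce3f547605; 132 l.; MECHANICAL (iib-R) rewrite v3.1 of the PKG file as it stands (130 token edits; rules R1x1+R5x1+RX[h₂]x128)) (`HOME/mc/pub-hodgecm-mc-axioms-1-g14/revendor/kit-r55/stage55/HodgeCM/Model/E2InstanceOR8.lean`, md5 5cce3f547605, 132 lines);
landed by the gen-22 packager (p-g22) in gate run 55 REPLACES the earlier landed copy of `HodgeCM/Model/E2InstanceOR8.lean` (seat copy carried the packager Origin header of an earlier run (stripped)).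
-/
/-
Origin: glue-1 lane, seat `planner-pub-hodgecm-mc-glue-1-g9-0` (unit pub-hodgecm-mc-glue-1-g9), 2026-08-20 — item (ORIENT-h) — E-side DESIGN OF RECORD (lead 1-g59 ruling STATUS 2026-08-20T04:17:04Z l.12517 (R2) + supplement 04:24:00Z (S1)(S2); model1-g10 TYPE ✓ / PATH ✓ 04:24:14Z); model1-g10 l.12493): the ORIENTED-FAMILY twin of `HodgeCM/Model/E2InstanceR8.lean` — PerL's recipe bit
chosen PER COMPLEX PLACE, `hb : ∀ L : CMField, (L →+* ℂ) → Bool`, every binder at the universe `(L, ι₁)` typed against the END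
STATE's theta model at bit `hb L ι₁`.  Generated by `tools/gen_O.py` from the installed source (statement verbatim modulo
`h ↦ hb L ι₁`); ADDITIVE LEAF, nothing in the package is touched; kernel-checked, no hypothesis of any kind added.
-/
import Summits.HodgeConjecture.HodgeCM.Model.E2InstanceO
import Summits.HodgeConjecture.HodgeCM.Model.E2InstanceR8

/-! PORT of `HodgeCM/Model/E2InstanceOR8.lean` (HodgeCMPerL run 82) — verbatim mechanical port; provenance in the PORT header line. -/

noncomputable section

open scoped TensorProduct InnerProductSpace Matrix

namespace HodgeCM

namespace Model

open HodgeCM.Universe (AdelicThetaCore AdelicThetaCore₀ SideData ThetaModel ModelAxiomsPerL)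
open Literature.AlgebraicGeometry.HodgeTheory
open Literature.AlgebraicGeometry.ComplexMultiplication (Shimura1998_Thm3_isogenousPower Shimura1998_Thm2_Cor)
open Literature.NumberTheory.Automorphic.PicardCM
open Literature.NumberTheory.Transcendental (Arapura2012_Cor_15_4_6)
open HodgeCM.CMTypeOps (inflate)
open HodgeCM.Model.SupplyInstance (LineSupplyData)
open HodgeCM.Model.SupplyResidual (ClassSupplyPackN)

variable (hHD : exists_isReal_hodgeModel) (hI : hodgePQ_independent_of_hodgeModel)
  (h₁ : BallQuotientUniformised)  (h₃ : CMAbelianVarietyRealised)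

/-- ORIENTED-FAMILY twin of `thetaSub_of_fact` (statement `h ↦ hb L ι₁`, proof verbatim). -/
theorem thetaSub_of_factO (hb : ∀ L : CMField, (L →+* ℂ) → Bool) (hA : Arapura2012_Cor_15_4_6)
    (W : ∀ {L : CMField} {ι₁ : L →+* ℂ} (V : HermSpace3 L ι₁) (c : SeesawCtx L), WmInput V c.D)
    (X : ∀ {L : CMField} {ι₁ : L →+* ℂ} (V : HermSpace3 L ι₁) (c : SeesawCtx L),
      ThetaSpaceInput (picardCMUniverse hHD hI h₁ h₃) V c)
    (μ : ∀ {L : CMField}, SeesawCtx L → Fin 4 → NumberField.InfinitePlace L → ℤ)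
    (h31 : (picardCMUniverse hHD hI h₁ h₃).Fact_cmInflation)
    (hLiu : ∀ {L : CMField} {ι₁ : L →+* ℂ} (V : HermSpace3 L ι₁) (c : SeesawCtx L),
      (thetaModelOf hHD hI h₁ h₃ (hb L ι₁) (embOf hHD hI h₁ h₃) (coverOf hHD hI h₁ h₃ hA) (wmOfInput W) (thetaOf _ (thetaClassInputOf _ X)) (d12Of μ) (d34Of μ)).GoodCtx ι₁ c → Module.finrank ℚ c.K = 6 →
      ∀ (i : Fin 4) (Γ : Level V), ∃ (M : CMField) (k : c.K →+* M) (σ' : M →+* ℂ), σ'.comp k = c.σ ∧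
        (thetaModelOf hHD hI h₁ h₃ (hb L ι₁) (embOf hHD hI h₁ h₃) (coverOf hHD hI h₁ h₃ hA) (wmOfInput W) (thetaOf _ (thetaClassInputOf _ X)) (d12Of μ) (d34Of μ)).Theta V c i Γ ⊆
          (picardCMUniverse hHD hI h₁ h₃).Uiso Γ M (inflate k (c.Ψ i)) σ')
    {L : CMField} {ι₁ : L →+* ℂ} (V : HermSpace3 L ι₁) (c : SeesawCtx L)
    (hc : (thetaModelOf hHD hI h₁ h₃ (hb L ι₁) (embOf hHD hI h₁ h₃) (coverOf hHD hI h₁ h₃ hA) (wmOfInput W) (thetaOf _ (thetaClassInputOf _ X)) (d12Of μ) (d34Of μ)).GoodCtx ι₁ c) (hK : Module.finrank ℚ c.K = 6) (i : Fin 4) (Γ : Level V) :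
    (thetaModelOf hHD hI h₁ h₃ (hb L ι₁) (embOf hHD hI h₁ h₃) (coverOf hHD hI h₁ h₃ hA) (wmOfInput W) (thetaOf _ (thetaClassInputOf _ X)) (d12Of μ) (d34Of μ)).Theta V c i Γ ⊆
      (picardCMUniverse hHD hI h₁ h₃).Uiso Γ c.K (c.Ψ i) c.σ := by
  intro ω hω
  obtain ⟨M, k, σ', hσ, hsub⟩ := hLiu V c hc hK i Γ
  have hle := Universe.Uiso_inflate_le (Model.modelAxiomsPerL hHD hI h₃ h₁).pull_comp
    (Model.fact_alphaLine (hHD := hHD) (hI := hI) (h₁ := h₁) (h₃ := h₃))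
    h31 Γ c.K M k (c.Ψ i) σ' (hsub hω)
  rw [hσ] at hle
  exact hle

/-- **ORIENTED-FAMILY twin of `perL_picardCM_r8core`** (`E2InstanceR8`): the recipe bit per complex place, `h ↦ hb L ι₁` in every binder;
proof = the source proof over the oriented predecessor. -/
theorem perL_picardCM_r8coreO (hHR : BettiUniverse.HodgeRiemann20) (hb : ∀ L : CMField, (L →+* ℂ) → Bool)
    (hA : Arapura2012_Cor_15_4_6)
    (W : ∀ {L : CMField} {ι₁ : L →+* ℂ} (V : HermSpace3 L ι₁) (c : SeesawCtx L), WmInput V c.D)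
    (X : ∀ {L : CMField} {ι₁ : L →+* ℂ} (V : HermSpace3 L ι₁) (c : SeesawCtx L),
      ThetaSpaceInput (picardCMUniverse hHD hI h₁ h₃) V c)
    (μ : ∀ {L : CMField}, SeesawCtx L → Fin 4 → NumberField.InfinitePlace L → ℤ)
    (hBetti : ∀ {L : CMField} {ι₁ : L →+* ℂ} (V : HermSpace3 L ι₁), EmbBettiSide hHD hI h₁ h₃ V)
    (h31 : (picardCMUniverse hHD hI h₁ h₃).Fact_cmInflation)
    (hLiu : ∀ {L : CMField} {ι₁ : L →+* ℂ} (V : HermSpace3 L ι₁) (c : SeesawCtx L),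
      (thetaModelOf hHD hI h₁ h₃ (hb L ι₁) (embOf hHD hI h₁ h₃) (coverOf hHD hI h₁ h₃ hA) (wmOfInput W) (thetaOf _ (thetaClassInputOf _ X)) (d12Of μ) (d34Of μ)).GoodCtx ι₁ c → Module.finrank ℚ c.K = 6 →
      ∀ (i : Fin 4) (Γ : Level V), ∃ (M : CMField) (k : c.K →+* M) (σ' : M →+* ℂ), σ'.comp k = c.σ ∧
        (thetaModelOf hHD hI h₁ h₃ (hb L ι₁) (embOf hHD hI h₁ h₃) (coverOf hHD hI h₁ h₃ hA) (wmOfInput W) (thetaOf _ (thetaClassInputOf _ X)) (d12Of μ) (d34Of μ)).Theta V c i Γ ⊆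
          (picardCMUniverse hHD hI h₁ h₃).Uiso Γ M (inflate k (c.Ψ i)) σ')
    (thetaSat : ∀ {L : CMField} {ι₁ : L →+* ℂ} (V : HermSpace3 L ι₁) (c : SeesawCtx L)
      (i : Fin 4) (Γ Γ' : Level V) (hle : Γ' ≤ Γ) (ω : (picardCMUniverse hHD hI h₁ h₃).CohC ((picardCMUniverse hHD hI h₁ h₃).pms L ι₁ V Γ) 1),
      ω ∈ (thetaModelOf hHD hI h₁ h₃ (hb L ι₁) (embOf hHD hI h₁ h₃) (coverOf hHD hI h₁ h₃ hA) (wmOfInput W) (thetaOf _ (thetaClassInputOf _ X)) (d12Of μ) (d34Of μ)).Theta V c i Γ →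
        (picardCMUniverse hHD hI h₁ h₃).pullC (coverOf hHD hI h₁ h₃ hA Γ Γ' (Level.Γ_mono hle)) 1 ω ∈ (thetaModelOf hHD hI h₁ h₃ (hb L ι₁) (embOf hHD hI h₁ h₃) (coverOf hHD hI h₁ h₃ hA) (wmOfInput W) (thetaOf _ (thetaClassInputOf _ X)) (d12Of μ) (d34Of μ)).Theta V c i Γ')
    (transl : ∀ {L : CMField} {ι₁ : L →+* ℂ} (V : HermSpace3 L ι₁) (c : SeesawCtx L)
      (hc : (thetaModelOf hHD hI h₁ h₃ (hb L ι₁) (embOf hHD hI h₁ h₃) (coverOf hHD hI h₁ h₃ hA) (wmOfInput W) (thetaOf _ (thetaClassInputOf _ X)) (d12Of μ) (d34Of μ)).GoodCtx ι₁ c) (hK : Module.finrank ℚ c.K = 6),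
      ∀ γ ∈ (ballOf hHD hI h₁ h₃ V c (two_lt_finrank_of_goodCtx hHD hI h₁ h₃ hc hK)).Δ, ∀ (i : Fin 4) (Γ : Level V) (ω : (picardCMUniverse hHD hI h₁ h₃).CohC ((picardCMUniverse hHD hI h₁ h₃).pms L ι₁ V Γ) 1),
      ω ∈ (thetaModelOf hHD hI h₁ h₃ (hb L ι₁) (embOf hHD hI h₁ h₃) (coverOf hHD hI h₁ h₃ hA) (wmOfInput W) (thetaOf _ (thetaClassInputOf _ X)) (d12Of μ) (d34Of μ)).Theta V c i Γ → ∃ (Γ' : Level V) (ω' : (picardCMUniverse hHD hI h₁ h₃).CohC ((picardCMUniverse hHD hI h₁ h₃).pms L ι₁ V Γ') 1),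
        ω' ∈ (thetaModelOf hHD hI h₁ h₃ (hb L ι₁) (embOf hHD hI h₁ h₃) (coverOf hHD hI h₁ h₃ hA) (wmOfInput W) (thetaOf _ (thetaClassInputOf _ X)) (d12Of μ) (d34Of μ)).Theta V c i Γ' ∧ (ballOf hHD hI h₁ h₃ V c (two_lt_finrank_of_goodCtx hHD hI h₁ h₃ hc hK)).ev Γ' ω' =
          fun x => (ballOf hHD hI h₁ h₃ V c (two_lt_finrank_of_goodCtx hHD hI h₁ h₃ hc hK)).J γ x *ᵥ (ballOf hHD hI h₁ h₃ V c (two_lt_finrank_of_goodCtx hHD hI h₁ h₃ hc hK)).ev Γ ω (γ • x))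
    (A : ∀ {L : CMField} {ι₁ : L →+* ℂ} (V : HermSpace3 L ι₁) (c : SeesawCtx L),
      (thetaModelOf hHD hI h₁ h₃ (hb L ι₁) (embOf hHD hI h₁ h₃) (coverOf hHD hI h₁ h₃ hA) (wmOfInput W) (thetaOf _ (thetaClassInputOf _ X)) (d12Of μ) (d34Of μ)).GoodCtx ι₁ c → Module.finrank ℚ c.K = 6 →
        ∀ k : Fin 4, k = 0 ∨ k = 1 → ∀ N : ℕ, 0 < N → SupplySituationAt (X V c) k N)
    (gen12 : ∀ {L : CMField} {ι₁ : L →+* ℂ} (V : HermSpace3 L ι₁) (c : SeesawCtx L),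
      (thetaModelOf hHD hI h₁ h₃ (hb L ι₁) (embOf hHD hI h₁ h₃) (coverOf hHD hI h₁ h₃ hA) (wmOfInput W) (thetaOf _ (thetaClassInputOf _ X)) (d12Of μ) (d34Of μ)).GoodCtx ι₁ c → Module.finrank ℚ c.K = 6 →
      Nonempty ((thetaModelOf hHD hI h₁ h₃ (hb L ι₁) (embOf hHD hI h₁ h₃) (coverOf hHD hI h₁ h₃ hA) (wmOfInput W) (thetaOf _ (thetaClassInputOf _ X)) (d12Of μ) (d34Of μ)).Gen12FunBridge V c))
    (real34 : ∀ {L : CMField} {ι₁ : L →+* ℂ} (V : HermSpace3 L ι₁) (c : SeesawCtx L),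
      (thetaModelOf hHD hI h₁ h₃ (hb L ι₁) (embOf hHD hI h₁ h₃) (coverOf hHD hI h₁ h₃ hA) (wmOfInput W) (thetaOf _ (thetaClassInputOf _ X)) (d12Of μ) (d34Of μ)).GoodCtx ι₁ c → Module.finrank ℚ c.K = 6 →
      Nonempty ((thetaModelOf hHD hI h₁ h₃ (hb L ι₁) (embOf hHD hI h₁ h₃) (coverOf hHD hI h₁ h₃ hA) (wmOfInput W) (thetaOf _ (thetaClassInputOf _ X)) (d12Of μ) (d34Of μ)).Real34FunBridge V c))
    (hyp12 : ∀ {L : CMField} {ι₁ : L →+* ℂ} (V : HermSpace3 L ι₁) (c : SeesawCtx L),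
      (thetaModelOf hHD hI h₁ h₃ (hb L ι₁) (embOf hHD hI h₁ h₃) (coverOf hHD hI h₁ h₃ hA) (wmOfInput W) (thetaOf _ (thetaClassInputOf _ X)) (d12Of μ) (d34Of μ)).GoodCtx ι₁ c → Module.finrank ℚ c.K = 6 →
      Nonempty (((coreOf _ (embOf hHD hI h₁ h₃) (coverOf hHD hI h₁ h₃ hA) (wmOfInput W) (thetaOf _ (thetaClassInputOf _ X))).toCore (hb L ι₁)).HypSmoothCore12
        (((coreOf _ (embOf hHD hI h₁ h₃) (coverOf hHD hI h₁ h₃ hA) (wmOfInput W) (thetaOf _ (thetaClassInputOf _ X))).toCore (hb L ι₁)).side12 (d12Of μ)) (((coreOf _ (embOf hHD hI h₁ h₃) (coverOf hHD hI h₁ h₃ hA) (wmOfInput W) (thetaOf _ (thetaClassInputOf _ X))).toCore (hb L ι₁)).side34 (d34Of μ))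
        ((((coreOf _ (embOf hHD hI h₁ h₃) (coverOf hHD hI h₁ h₃ hA) (wmOfInput W) (thetaOf _ (thetaClassInputOf _ X))).toCore (hb L ι₁)).analyticKM (((coreOf _ (embOf hHD hI h₁ h₃) (coverOf hHD hI h₁ h₃ hA) (wmOfInput W) (thetaOf _ (thetaClassInputOf _ X))).toCore (hb L ι₁)).side12 (d12Of μ))
          (((coreOf _ (embOf hHD hI h₁ h₃) (coverOf hHD hI h₁ h₃ hA) (wmOfInput W) (thetaOf _ (thetaClassInputOf _ X))).toCore (hb L ι₁)).side34 (d34Of μ))).toAnalytic) V c (ℓ := linOfInput W V c)))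
    (hyp34 : ∀ {L : CMField} {ι₁ : L →+* ℂ} (V : HermSpace3 L ι₁) (c : SeesawCtx L),
      (thetaModelOf hHD hI h₁ h₃ (hb L ι₁) (embOf hHD hI h₁ h₃) (coverOf hHD hI h₁ h₃ hA) (wmOfInput W) (thetaOf _ (thetaClassInputOf _ X)) (d12Of μ) (d34Of μ)).GoodCtx ι₁ c → Module.finrank ℚ c.K = 6 →
      Nonempty (((coreOf _ (embOf hHD hI h₁ h₃) (coverOf hHD hI h₁ h₃ hA) (wmOfInput W) (thetaOf _ (thetaClassInputOf _ X))).toCore (hb L ι₁)).HypSmoothCore34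
        (((coreOf _ (embOf hHD hI h₁ h₃) (coverOf hHD hI h₁ h₃ hA) (wmOfInput W) (thetaOf _ (thetaClassInputOf _ X))).toCore (hb L ι₁)).side12 (d12Of μ)) (((coreOf _ (embOf hHD hI h₁ h₃) (coverOf hHD hI h₁ h₃ hA) (wmOfInput W) (thetaOf _ (thetaClassInputOf _ X))).toCore (hb L ι₁)).side34 (d34Of μ))
        ((((coreOf _ (embOf hHD hI h₁ h₃) (coverOf hHD hI h₁ h₃ hA) (wmOfInput W) (thetaOf _ (thetaClassInputOf _ X))).toCore (hb L ι₁)).analyticKM (((coreOf _ (embOf hHD hI h₁ h₃) (coverOf hHD hI h₁ h₃ hA) (wmOfInput W) (thetaOf _ (thetaClassInputOf _ X))).toCore (hb L ι₁)).side12 (d12Of μ))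
          (((coreOf _ (embOf hHD hI h₁ h₃) (coverOf hHD hI h₁ h₃ hA) (wmOfInput W) (thetaOf _ (thetaClassInputOf _ X))).toCore (hb L ι₁)).side34 (d34Of μ))).toAnalytic) V c (ℓ := linOfInput W V c))) :
    (picardCMUniverse hHD hI h₁ h₃).PerL :=
  perL_picardCMO hHD hI h₁ h₃ hHR hb (embOf hHD hI h₁ h₃) (coverOf hHD hI h₁ h₃ hA) (wmOfInput W)
    (thetaOf _ (thetaClassInputOf _ X)) (d12Of μ) (d34Of μ)
    (fun {L} {ι₁} V c hc hK => innerEmbAt_of_bettiSide hHD hI h₁ h₃ (hb L ι₁) (coverOf hHD hI h₁ h₃ hA) (wmOfInput W)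
      (thetaOf _ (thetaClassInputOf _ X)) (d12Of μ) (d34Of μ) V
      ((HermSpace3.isAnisotropic_iff_finrank_ne_two V).2 (two_lt_finrank_of_goodCtx hHD hI h₁ h₃ hc hK).ne')
      (hBetti V))
    (thetaSub_of_factO hHD hI h₁ h₃ hb hA W X μ h31 hLiu)
    (fun {L} {ι₁} V c hc hK => (thetaModelOf hHD hI h₁ h₃ (hb L ι₁) (embOf hHD hI h₁ h₃) (coverOf hHD hI h₁ h₃ hA) (wmOfInput W) (thetaOf _ (thetaClassInputOf _ X)) (d12Of μ) (d34Of μ)).exists_cup_ne_zero_of_ballFacts V c (ballOf hHD hI h₁ h₃ V c (two_lt_finrank_of_goodCtx hHD hI h₁ h₃ hc hK))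
      (ballFactsOf hHD hI h₁ h₃ V c _ (thetaModelOf hHD hI h₁ h₃ (hb L ι₁) (embOf hHD hI h₁ h₃) (coverOf hHD hI h₁ h₃ hA) (wmOfInput W) (thetaOf _ (thetaClassInputOf _ X)) (d12Of μ) (d34Of μ))
        (thetaSub_of_factO hHD hI h₁ h₃ hb hA W X μ h31 hLiu V c hc hK) (thetaSat V c)
        (fun Γ Γ' hle hV v hv => map_coverOf_unif hHD hI h₁ h₃ hA hle hV hv) (transl V c hc hK))
      (by
        let S₀ := classSupplyPackNOf (X V c) 0 (thetaModelOf hHD hI h₁ h₃ (hb L ι₁) (embOf hHD hI h₁ h₃) (coverOf hHD hI h₁ h₃ hA) (wmOfInput W) (thetaOf _ (thetaClassInputOf _ X)) (d12Of μ) (d34Of μ))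
          (fun _ _ hx => hx) (A V c hc hK 0 (Or.inl rfl))
        let S₁ := classSupplyPackNOf (X V c) 1 (thetaModelOf hHD hI h₁ h₃ (hb L ι₁) (embOf hHD hI h₁ h₃) (coverOf hHD hI h₁ h₃ hA) (wmOfInput W) (thetaOf _ (thetaClassInputOf _ X)) (d12Of μ) (d34Of μ))
          (fun _ _ hx => hx) (A V c hc hK 1 (Or.inr rfl))
        exact ⟨S₀.toPairSupplyData.toLineSupplyData.D.supply S₀.toPairSupplyData.toLineSupplyData.res,
          S₁.toPairSupplyData.toLineSupplyData.D.supply S₁.toPairSupplyData.toLineSupplyData.res⟩))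
    gen12 real34
    (fun {L} {ι₁} V c hc hK =>
      ⟨fun Φ i hΦ => (hyp12 V c hc hK).elim fun A => A.H_occ (ℓ := linOfInput W V c) Φ i hΦ,
        fun Φ i hΦ => (hyp34 V c hc hK).elim fun A => A.H_occ (ℓ := linOfInput W V c) Φ i hΦ⟩)

end Model

end HodgeCM

end
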